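import Mathlib.Analysis.SpecialFunctions.Pow.Integral
import Mathlib.Analysis.InnerProductSpace.PiL2
import Mathlib.MeasureTheory.Integral.Average
import Mathlib.MeasureTheory.Measure.Lebesgue.VolumeOfBalls
import HarnessLib

/-!
# Crux `HistoryTailL` (stmt-QuantumFields-19936), K2 organ `hImproveCoreFlat`, road R1 brick B2′ — FILE H-2 «PROJECTION AVERAGING IN `ℝ⁴`»:
# a weighted finite point set in the closed unit ball of `ℝ⁴` admits a centre `p ∈ B_{1∕2}`, off any prescribed countable set, with
# `Σ_b c_b·‖q_b − p‖⁻² ≤ K·Σ_b c_b` — the Hardt–Kinderlehrer–Lin average (`‖·‖⁻²` is integrable in dimension `4 > 2`)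

Cell `ym3-torus` (YM ladder rung R3 = continuum SU(2) Yang–Mills on T³ — a RUNG, NOT the Clay problem: not d = 4, not infinite volume, not a mass
gap); TWIN-WIDTH helper seat `ym-ust-19936-w7` g13.  Helper `--supports stmt-QuantumFields-19936`; THEOREMS ONLY (0 `def`, 0 `sorry`, default
heartbeats), Mathlib only (`EuclideanSpace ℝ (Fin 4)`, Lebesgue measure).

WHY.  File H-1 bounds the ray projection bond by bond: `‖π_p(y) − π_p(z)‖² ≤ 36‖y − z‖²∕‖y − p‖²`.  Summing over the bonds of a lattice map and
AVERAGING over the centre `p ∈ B_{1∕2} ⊂ ℝ⁴` turns the singular weights `‖y_b − p‖⁻²` into the constant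
`K := (∫_{B_2(0)} ‖x‖⁻² dx) ∕ |B_{1∕2}|` (translation invariance and `B_{1∕2}(0) ⊆ B_2(y)` for `‖y‖ ≤ 1`); some centre does at least as well as
the average (`exists_le_setAverage`), and it can be taken off any countable set (null for Lebesgue measure) — in H-3, off the range of the
interpolated lattice map, so that the projection is defined at every site.

WHAT IS PROVED (ns `…Theorems.PoincareLipschitzProjectionAveraging`).
* §1 `integrableOn_inv_norm_sq_ball` (`x ↦ (‖x‖²)⁻¹` integrable on balls about `0` in `ℝ⁴`, Mathlib ✓`integrableOn_ball_of_norm_le_rpow` at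
  `2 < 4`), `preimage_sub_ball`, `integrableOn_inv_norm_sub_sq_ball` + `setIntegral_inv_norm_sub_sq_eq` (translation to the centre `q`),
  ★`setIntegral_inv_norm_sub_sq_le` (`∫_{B_{1∕2}(0)} ‖q − p‖⁻² dp ≤ I₀ := ∫_{B_2(0)}‖x‖⁻² dx` for `‖q‖ ≤ 1`).
* §2 ★★★ `exists_centre_weighted_le` — ∃ `K ≥ 0` ∀ finite weighted families `(c_b ≥ 0, ‖q_b‖ ≤ 1)` ∀ countable `N`:
  ∃ `p`, `‖p‖ < ½`, `p ∉ N`, `Σ_b c_b (‖q_b − p‖²)⁻¹ ≤ K·Σ_b c_b`.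
HONEST SCOPE.  Measure-theoretic bookkeeping; NOTHING here proves `hImproveCoreFlat`, K1, `MeanDeviationL`, `BlockLipschitzL` or `HistoryTailL`.
YM₃ on T³ is rung R3, not Clay; YM gap NOT proved; no summit statement is proved here.

References: R. Hardt, D. Kinderlehrer, F.-H. Lin, Comm. Math. Phys. 105 (1986) 547–570 [HardtKinderlehrerLin1986] (§2, the averaging device).
-/

set_option autoImplicit false

noncomputable section

open MeasureTheory Metric Set
open scoped BigOperators

namespace Summit.QuantumFields.YangMills.Theorems.PoincareLipschitzProjectionAveraging

/-! ## §1 Integrability of `‖·‖⁻²` on balls of `ℝ⁴` and the translated bound -/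

/-- `x ↦ (‖x‖²)⁻¹` is integrable on every ball about the origin of `ℝ⁴` (`2 < 4 = dim`). [folklore]
[cite: HardtKinderlehrerLin1986, §2] -/
theorem integrableOn_inv_norm_sq_ball (r : ℝ) :
    IntegrableOn (fun x : EuclideanSpace ℝ (Fin 4) => (‖x‖ ^ 2)⁻¹) (ball 0 r) volume := by
  refine integrableOn_ball_of_norm_le_rpow (E := EuclideanSpace ℝ (Fin 4)) (μ := volume)
    (by rw [finrank_euclideanSpace_fin]; norm_num) (C := 1) (α := 2)
    (by rw [finrank_euclideanSpace_fin]; norm_num) (Filter.Eventually.of_forall fun x => ?_) ?_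
  · rw [Real.norm_of_nonneg (by positivity), one_mul, Real.rpow_neg (norm_nonneg _), Real.rpow_two]
  · exact ((continuous_norm.pow 2).measurable.inv).aestronglyMeasurable

/-- The translate `p ↦ p − q` pulls the ball about `0` back to the ball about `q`. [folklore] -/
theorem preimage_sub_ball (q : EuclideanSpace ℝ (Fin 4)) (r : ℝ) :
    (fun p : EuclideanSpace ℝ (Fin 4) => p - q) ⁻¹' (ball 0 r) = ball q r := by
  ext p
  simp [dist_eq_norm]

/-- `p ↦ (‖q − p‖²)⁻¹` is integrable on every ball about `q` (translation invariance of Lebesgue measure). [folklore]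
[cite: HardtKinderlehrerLin1986, §2] -/
theorem integrableOn_inv_norm_sub_sq_ball (q : EuclideanSpace ℝ (Fin 4)) (r : ℝ) :
    IntegrableOn (fun p : EuclideanSpace ℝ (Fin 4) => (‖q - p‖ ^ 2)⁻¹) (ball q r) volume := by
  have hmp : MeasurePreserving (fun p : EuclideanSpace ℝ (Fin 4) => p - q) volume volume :=
    measurePreserving_sub_right volume q
  have hemb : MeasurableEmbedding (fun p : EuclideanSpace ℝ (Fin 4) => p - q) :=
    (MeasurableEquiv.subRight q).measurableEmbedding
  have h := (hmp.integrableOn_comp_preimage hemb).mpr (integrableOn_inv_norm_sq_ball r)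
  rw [preimage_sub_ball] at h
  refine h.congr_fun (fun p _ => ?_) measurableSet_ball
  simp only [Function.comp_apply, norm_sub_rev]

/-- The translated integral equals the central one: `∫_{B_r(q)} (‖q − p‖²)⁻¹ dp = ∫_{B_r(0)} (‖x‖²)⁻¹ dx`. [folklore]
[cite: HardtKinderlehrerLin1986, §2] -/
theorem setIntegral_inv_norm_sub_sq_eq (q : EuclideanSpace ℝ (Fin 4)) (r : ℝ) :
    ∫ p in ball q r, (‖q - p‖ ^ 2)⁻¹ = ∫ x in ball (0 : EuclideanSpace ℝ (Fin 4)) r, (‖x‖ ^ 2)⁻¹ := by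
  have hmp : MeasurePreserving (fun p : EuclideanSpace ℝ (Fin 4) => p - q) volume volume :=
    measurePreserving_sub_right volume q
  have hemb : MeasurableEmbedding (fun p : EuclideanSpace ℝ (Fin 4) => p - q) :=
    (MeasurableEquiv.subRight q).measurableEmbedding
  have h := hmp.setIntegral_preimage_emb hemb (fun x : EuclideanSpace ℝ (Fin 4) => (‖x‖ ^ 2)⁻¹) (ball 0 r)
  rw [preimage_sub_ball] at h
  rw [← h]
  refine setIntegral_congr_fun measurableSet_ball fun p _ => ?_
  simp only [norm_sub_rev]

/-- ★ THE UNIFORM BOUND: for `‖q‖ ≤ 1`, `∫_{B_{1∕2}(0)} (‖q − p‖²)⁻¹ dp ≤ I₀ := ∫_{B_2(0)} (‖x‖²)⁻¹ dx` (since `B_{1∕2}(0) ⊆ B_2(q)` and the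
integrand is nonnegative). [cite: HardtKinderlehrerLin1986, §2] -/
theorem setIntegral_inv_norm_sub_sq_le (q : EuclideanSpace ℝ (Fin 4)) (hq : ‖q‖ ≤ 1) :
    ∫ p in ball (0 : EuclideanSpace ℝ (Fin 4)) (1 / 2), (‖q - p‖ ^ 2)⁻¹ ≤
      ∫ x in ball (0 : EuclideanSpace ℝ (Fin 4)) 2, (‖x‖ ^ 2)⁻¹ := by
  rw [← setIntegral_inv_norm_sub_sq_eq q 2]
  refine setIntegral_mono_set (integrableOn_inv_norm_sub_sq_ball q 2) ?_ ?_
  · exact Filter.Eventually.of_forall fun p => by positivity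
  · refine ae_of_all _ fun p hp => ?_
    change p ∈ ball (0 : EuclideanSpace ℝ (Fin 4)) (1 / 2) at hp
    change p ∈ ball q 2
    rw [mem_ball_zero_iff] at hp
    rw [mem_ball, dist_eq_norm]
    calc ‖p - q‖ ≤ ‖p‖ + ‖q‖ := norm_sub_le p q
      _ < 1 / 2 + 1 := by linarith
      _ ≤ 2 := by norm_num

/-! ## §2 The averaged centre -/

/-- ★★★ **HARDT–KINDERLEHRER–LIN AVERAGING, FINITE FORM.**  There is `K ≥ 0` (namely `I₀ ∕ |B_{1∕2}|`) such that every finite family of points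
`q_b` of the closed unit ball of `ℝ⁴` with weights `c_b ≥ 0`, and every countable exceptional set `N`, admit a centre `p` with `‖p‖ < ½`, `p ∉ N`
and `Σ_b c_b·(‖q_b − p‖²)⁻¹ ≤ K·Σ_b c_b` — some centre does at least as well as the Lebesgue average over `B_{1∕2} ∖ N`.
[cite: HardtKinderlehrerLin1986, §2] -/
theorem exists_centre_weighted_le.{u} : ∃ K : ℝ, 0 ≤ K ∧
    ∀ (β : Type u) (T : Finset β) (c : β → ℝ) (q : β → EuclideanSpace ℝ (Fin 4)) (N : Set (EuclideanSpace ℝ (Fin 4))),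
      (∀ b ∈ T, 0 ≤ c b) → (∀ b ∈ T, ‖q b‖ ≤ 1) → N.Countable →
      ∃ p : EuclideanSpace ℝ (Fin 4), ‖p‖ < 1 / 2 ∧ p ∉ N ∧
        ∑ b ∈ T, c b * (‖q b - p‖ ^ 2)⁻¹ ≤ K * ∑ b ∈ T, c b := by
  classical
  set I₀ : ℝ := ∫ x in ball (0 : EuclideanSpace ℝ (Fin 4)) 2, (‖x‖ ^ 2)⁻¹ with hI₀
  set B : Set (EuclideanSpace ℝ (Fin 4)) := ball 0 (1 / 2) with hB
  have hBpos : 0 < volume B := measure_ball_pos volume (0 : EuclideanSpace ℝ (Fin 4)) (by norm_num)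
  have hBtop : volume B < ⊤ := measure_ball_lt_top
  have hV0 : 0 < (volume B).toReal := ENNReal.toReal_pos hBpos.ne' hBtop.ne
  have hI₀0 : 0 ≤ I₀ := setIntegral_nonneg measurableSet_ball fun x _ => by positivity
  refine ⟨I₀ / (volume B).toReal, div_nonneg hI₀0 hV0.le, ?_⟩
  intro β T c q N hc hq hN
  -- the averaging set: the ball minus the countable exceptional set
  set S : Set (EuclideanSpace ℝ (Fin 4)) := B \ N with hS
  have hN0 : volume N = 0 := hN.measure_zero volume
  have hSvol : volume S = volume B := measure_sdiff_null hN0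
  have hS0 : volume S ≠ 0 := by rw [hSvol]; exact hBpos.ne'
  have hStop : volume S ≠ ⊤ := by rw [hSvol]; exact hBtop.ne
  have hSB : S ⊆ B := fun x hx => hx.1
  -- the weight function and its integrability on the ball
  set G : EuclideanSpace ℝ (Fin 4) → ℝ := fun p => ∑ b ∈ T, c b * (‖q b - p‖ ^ 2)⁻¹ with hG
  have hIb : ∀ b ∈ T, IntegrableOn (fun p : EuclideanSpace ℝ (Fin 4) => (‖q b - p‖ ^ 2)⁻¹) B volume := by
    intro b hb
    refine (integrableOn_inv_norm_sub_sq_ball (q b) 2).mono_set fun p hp => ?_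
    rw [hB, mem_ball_zero_iff] at hp
    rw [mem_ball, dist_eq_norm]
    calc ‖p - q b‖ ≤ ‖p‖ + ‖q b‖ := norm_sub_le _ _
      _ < 1 / 2 + 1 := by linarith [hq b hb]
      _ ≤ 2 := by norm_num
  have hGint : IntegrableOn G B volume := by
    rw [hG]
    exact integrable_finsetSum T fun b hb => (hIb b hb).const_mul (c b)
  have hGintS : IntegrableOn G S volume := hGint.mono_set hSB
  have hGnn : ∀ p, 0 ≤ G p := fun p => Finset.sum_nonneg fun b hb => mul_nonneg (hc b hb) (by positivity)
  -- the integral of `G` over the ball is at most `I₀ Σ c_b`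
  have hGle : ∫ p in B, G p ≤ I₀ * ∑ b ∈ T, c b := by
    rw [hG, integral_finsetSum T fun b hb => (hIb b hb).const_mul (c b), Finset.mul_sum]
    refine Finset.sum_le_sum fun b hb => ?_
    rw [integral_const_mul]  -- `∫ c * f = c * ∫ f`
    rw [mul_comm]
    exact mul_le_mul_of_nonneg_right (setIntegral_inv_norm_sub_sq_le (q b) (hq b hb)) (hc b hb)
  have hGleS : ∫ p in S, G p ≤ I₀ * ∑ b ∈ T, c b :=
    le_trans (setIntegral_mono_set hGint (Filter.Eventually.of_forall hGnn) (ae_of_all _ fun x hx => hSB hx)) hGle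
  -- some point of `S` is below the average
  obtain ⟨p, hpS, hple⟩ := exists_le_setAverage hS0 hStop hGintS
  refine ⟨p, ?_, hpS.2, ?_⟩
  · have := hSB hpS; rwa [hB, mem_ball_zero_iff] at this
  · calc G p ≤ ⨍ a in S, G a := hple
      _ = (volume S).toReal⁻¹ * ∫ a in S, G a := by rw [setAverage_eq, smul_eq_mul]; rfl
      _ ≤ (volume S).toReal⁻¹ * (I₀ * ∑ b ∈ T, c b) :=
          mul_le_mul_of_nonneg_left hGleS (inv_nonneg.mpr ENNReal.toReal_nonneg)
      _ = I₀ / (volume B).toReal * ∑ b ∈ T, c b := by rw [hSvol]; ring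

end Summit.QuantumFields.YangMills.Theorems.PoincareLipschitzProjectionAveraging

end
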